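import Mathlib
import Literature.Probability.Distributions.ComplexGaussianVectors
import Summits.QuantumFields.YangMills.Theorems.EguchiKawaiDirectionLadderGaussianRatioTail
import HarnessLib

/-!
# One column of a Haar unitary: the rigid subspace and the conditional small-ball bound

Linear-algebra and Gaussian input of the column-by-column small-ball bound for Haar unitaries
(stub B1 `stub_singleLinkRigidity` of crux `DirectionIncrement`, route `EguchiKawaiDirectionLadder`).

Fix a finite-dimensional complex inner product space `V`, a subspace `K` (the span of the columns
already built, with an orthonormal basis `w`) and a "costly" subspace `C` such that the previous
columns have small `C`-component: `∑ₗ ‖P_C wₗ‖² ≤ σ`.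

* `exists_rigid_subspace` — there is a subspace `G ≤ Kᗮ` of dimension `≥ dim C - ⌊2σ⌋` with
  `‖P_G v‖² ≤ 2 ‖P_C v‖²` for every `v ∈ Kᗮ` (spectral decomposition of the positive operator
  `P_C P_K P_C`, whose trace is `∑ₗ ‖P_C wₗ‖² ≤ σ`, so that at most `2σ` eigenvalues exceed `1/2`;
  on the rest of `C` the projection `P_{Kᗮ}` loses at most a factor `√2`).
* `stdGaussian_measure_column_event_le` — for `V = ℂ^N` and a standard Gaussian vector `g`, the
  event `‖P_C (P_{Kᗮ} g)‖² ≤ x ‖P_{Kᗮ} g‖²` (the new Gram–Schmidt column `P_{Kᗮ} g/‖P_{Kᗮ} g‖`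
  has `C`-mass at most `x`) has probability at most `2^{N-1} (4x)^{dim C - ⌊2σ⌋}` for
  `0 ≤ x ≤ 1/4` (`stdGaussian_prod_measure_normSq_le_choose` in the adapted basis `G ⊕ Gᗮ`).

All [folklore].
-/

noncomputable section

open MeasureTheory ProbabilityTheory Set Module Submodule
open Literature.Probability.Distributions
open scoped ENNReal InnerProductSpace ComplexOrder

namespace Summit.QuantumFields.YangMills.Theorems.EguchiKawaiDirectionLadder.HaarColumns

/-! ### The rigid subspace -/

section LinAlg

variable {V : Type*} [NormedAddCommGroup V] [InnerProductSpace ℂ V] [FiniteDimensional ℂ V]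

/-- `‖P_K x‖² = ∑ₗ |⟪wₗ, x⟫|²` for an orthonormal basis `w` of `K`. [folklore] -/
theorem norm_sq_starProjection_eq_sum (K : Submodule ℂ V) {ι : Type*} [Fintype ι]
    (w : OrthonormalBasis ι ℂ K) (x : V) :
    ‖K.starProjection x‖ ^ 2 = ∑ l, ‖⟪(w l : V), x⟫_ℂ‖ ^ 2 := by
  rw [starProjection_apply, Submodule.norm_coe,
    ← w.sum_sq_norm_inner_right (K.orthogonalProjectionOnto x)]
  refine Finset.sum_congr rfl fun l _ => ?_
  rw [Submodule.coe_inner, ← starProjection_apply, ← inner_starProjection_left_eq_right,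
    starProjection_eq_self_iff.2 (w l).2]

/-- **The rigid subspace.** If the orthonormal basis `w` of `K` has total `C`-mass
`∑ₗ ‖P_C wₗ‖² ≤ σ`, there is `G ≤ Kᗮ` with `dim G ≥ dim C - ⌊2σ⌋` and `‖P_G v‖² ≤ 2‖P_C v‖²` for
all `v ∈ Kᗮ`. [folklore] -/
theorem exists_rigid_subspace (K C : Submodule ℂ V) {ι : Type*} [Fintype ι]
    (w : OrthonormalBasis ι ℂ K) {σ : ℝ}
    (hσ : ∑ l, ‖C.starProjection (w l : V)‖ ^ 2 ≤ σ) :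
    ∃ G : Submodule ℂ V, G ≤ Kᗮ ∧ finrank ℂ C - ⌊2 * σ⌋₊ ≤ finrank ℂ G ∧
      finrank ℂ G ≤ finrank ℂ C ∧
      ∀ v ∈ Kᗮ, ‖G.starProjection v‖ ^ 2 ≤ 2 * ‖C.starProjection v‖ ^ 2 := by
  classical
  set n : ℕ := finrank ℂ V with hn
  -- the positive operator `B = P_C P_K P_C`
  set B : V →ₗ[ℂ] V :=
    ((C.starProjection ∘L K.starProjection ∘L C.starProjection : V →L[ℂ] V) : V →ₗ[ℂ] V) with hBdef
  have hBapp : ∀ x : V, B x = C.starProjection (K.starProjection (C.starProjection x)) := fun x => rfl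
  have hB : B.IsSymmetric := by
    intro x y
    rw [hBapp, hBapp, inner_starProjection_left_eq_right, inner_starProjection_left_eq_right,
      inner_starProjection_left_eq_right]
  set b := hB.eigenvectorBasis hn.symm with hb
  set β : Fin n → ℝ := hB.eigenvalues hn.symm with hβ
  have hBb : ∀ i, B (b i) = (β i : ℂ) • b i := fun i => hB.apply_eigenvectorBasis hn.symm i
  -- `⟪x, B x⟫ = ∑ β_i |⟪b_i, x⟫|²`
  have hquad : ∀ x : V, ⟪x, B x⟫_ℂ = ∑ i, (β i : ℂ) * (‖⟪b i, x⟫_ℂ‖ ^ 2 : ℝ) := by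
    intro x
    rw [← b.sum_inner_mul_inner x (B x)]
    refine Finset.sum_congr rfl fun i _ => ?_
    rw [← hB (b i) x, hBb, inner_smul_left, Complex.conj_ofReal, ← inner_conj_symm x (b i)]
    rw [mul_comm, mul_assoc, RCLike.mul_conj]; push_cast; rfl
  -- `⟪x, B x⟫ = ‖P_K P_C x‖²`
  have hquad' : ∀ x : V, ⟪x, B x⟫_ℂ = (‖K.starProjection (C.starProjection x)‖ ^ 2 : ℝ) := by
    intro x
    rw [hBapp, ← inner_starProjection_left_eq_right, ← inner_starProjection_left_eq_right]
    have h1 : K.starProjection (K.starProjection (C.starProjection x)) =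
        K.starProjection (C.starProjection x) :=
      starProjection_eq_self_iff.2 (starProjection_apply_mem _ _)
    conv_lhs => rw [← h1, inner_starProjection_left_eq_right]
    rw [inner_self_eq_norm_sq_to_K]; norm_cast
  -- eigenvalues are nonnegative, each is `‖P_K P_C b_i‖²`
  have hβi : ∀ i, β i = ‖K.starProjection (C.starProjection (b i))‖ ^ 2 := by
    intro i
    have h := hquad' (b i)
    rw [hBb, inner_smul_right, inner_self_eq_norm_sq_to_K, b.orthonormal.1 i] at h
    have h' : ((β i : ℝ) : ℂ) = ((‖K.starProjection (C.starProjection (b i))‖ ^ 2 : ℝ) : ℂ) := by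
      simpa using h
    exact_mod_cast h'
  have hβ0 : ∀ i, 0 ≤ β i := fun i => by rw [hβi]; positivity
  -- trace: `∑ β_i = ∑ₗ ‖P_C wₗ‖² ≤ σ`
  have htrace : ∑ i, β i ≤ σ := by
    have h1 : ∑ i, β i = ∑ i, ∑ l, ‖⟪(w l : V), C.starProjection (b i)⟫_ℂ‖ ^ 2 := by
      refine Finset.sum_congr rfl fun i _ => ?_
      rw [hβi, norm_sq_starProjection_eq_sum K w]
    rw [h1, Finset.sum_comm]
    refine le_trans (le_of_eq ?_) hσ
    refine Finset.sum_congr rfl fun l _ => ?_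
    rw [← b.sum_sq_norm_inner_left (C.starProjection (w l : V))]
    refine Finset.sum_congr rfl fun i _ => ?_
    rw [inner_starProjection_left_eq_right]
  -- the large eigenvalues
  set I : Finset (Fin n) := Finset.univ.filter fun i => 1 / 2 < β i with hI
  have hIcard : I.card ≤ ⌊2 * σ⌋₊ := by
    refine Nat.le_floor ?_
    have h1 : (I.card : ℝ) * (1 / 2) ≤ ∑ i ∈ I, β i := by
      have h := Finset.sum_le_sum fun i (hi : i ∈ I) => (Finset.mem_filter.1 hi).2.le
      simpa [Finset.sum_const, nsmul_eq_mul] using h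
    have h2 : ∑ i ∈ I, β i ≤ ∑ i, β i :=
      Finset.sum_le_sum_of_subset_of_nonneg (Finset.subset_univ _) fun i _ _ => hβ0 i
    linarith
  -- `L = span {b_i : i ∉ I}` and `C' = C ⊓ L`
  set L : Submodule ℂ V := span ℂ (Set.range fun i : {i // i ∉ I} => b i) with hL
  have hLrank : finrank ℂ L = n - I.card := by
    have hli : LinearIndependent ℂ (fun i : {i // i ∉ I} => b i) := by
      have := b.toBasis.linearIndependent.comp (fun i : {i // i ∉ I} => (i : Fin n))
        Subtype.val_injective
      simpa [Function.comp_def] using this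
    rw [hL, finrank_span_eq_card hli, Fintype.card_subtype_compl, Fintype.card_fin]
    simp
  set C' : Submodule ℂ V := C ⊓ L with hC'
  have hIn : I.card ≤ n := by simpa using I.card_le_univ
  have hC'rank : finrank ℂ C - I.card ≤ finrank ℂ C' := by
    have h1 := Submodule.finrank_sup_add_finrank_inf_eq C L
    have h2 : finrank ℂ ↥(C ⊔ L) ≤ n := Submodule.finrank_le _
    rw [hLrank, ← hC'] at h1
    have h3 : finrank ℂ C + (n - I.card) ≤ n + finrank ℂ C' := h1 ▸ (Nat.add_le_add_right h2 _)
    omega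
  have hC'le : finrank ℂ C' ≤ finrank ℂ C := Submodule.finrank_mono inf_le_left
  -- on `C'`, `‖P_K x‖² ≤ ‖x‖²/2`
  have hcoef : ∀ x ∈ C', ∀ i ∈ I, ⟪b i, x⟫_ℂ = 0 := by
    intro x hx i hi
    have hxL : x ∈ L := (Submodule.mem_inf.1 hx).2
    have hLle : L ≤ (ℂ ∙ b i)ᗮ := by
      rw [hL]
      refine Submodule.span_le.2 ?_
      rintro _ ⟨j, rfl⟩
      refine Submodule.mem_orthogonal_singleton_iff_inner_right.2 ?_
      have hij : i ≠ (j : Fin n) := fun h => j.2 (h ▸ hi)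
      rw [orthonormal_iff_ite.1 b.orthonormal, if_neg hij]
    exact Submodule.mem_orthogonal_singleton_iff_inner_right.1 (hLle hxL)
  have hsmall : ∀ x ∈ C', ‖K.starProjection x‖ ^ 2 ≤ (1 / 2) * ‖x‖ ^ 2 := by
    intro x hx
    have hxC : x ∈ C := (Submodule.mem_inf.1 hx).1
    have hPx : C.starProjection x = x := starProjection_eq_self_iff.2 hxC
    have hreal : ‖K.starProjection x‖ ^ 2 = ∑ i, β i * ‖⟪b i, x⟫_ℂ‖ ^ 2 := by
      have h := hquad' x
      rw [hPx, hquad] at h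
      exact_mod_cast h.symm
    rw [hreal, ← b.sum_sq_norm_inner_right x, Finset.mul_sum]
    refine Finset.sum_le_sum fun i _ => ?_
    by_cases hi : i ∈ I
    · rw [hcoef x hx i hi]; simp
    · have hβle : β i ≤ 1 / 2 := by
        by_contra h
        exact hi (Finset.mem_filter.2 ⟨Finset.mem_univ _, not_le.1 h⟩)
      exact mul_le_mul_of_nonneg_right hβle (by positivity)
  have hbig : ∀ x ∈ C', ‖x‖ ^ 2 ≤ 2 * ‖Kᗮ.starProjection x‖ ^ 2 := by
    intro x hx
    have h := norm_sq_eq_add_norm_sq_starProjection x K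
    have h' := hsmall x hx
    linarith
  -- `G = P_{Kᗮ} C'`
  set P : V →ₗ[ℂ] V := ((Kᗮ.starProjection : V →L[ℂ] V) : V →ₗ[ℂ] V) with hP
  have hPapp : ∀ x, P x = Kᗮ.starProjection x := fun x => rfl
  set G : Submodule ℂ V := C'.map P with hG
  have hinj : Function.Injective (P.domRestrict C') := by
    intro x y hxy
    apply Subtype.ext
    have h0 : P ((x : V) - y) = 0 := by
      rw [map_sub]; exact sub_eq_zero.2 hxy
    have h1 := hbig ((x : V) - y) (C'.sub_mem x.2 y.2)
    rw [← hPapp, h0, norm_zero] at h1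
    have h2 : ‖(x : V) - y‖ ^ 2 ≤ 0 := by linarith
    exact sub_eq_zero.1 (norm_eq_zero.1 (by nlinarith [norm_nonneg ((x : V) - y)]))
  have hGrank : finrank ℂ G = finrank ℂ C' := by
    have hr := LinearMap.finrank_range_of_inj hinj
    rw [LinearMap.range_domRestrict] at hr
    rw [hG, hr]
  refine ⟨G, ?_, ?_, hGrank ▸ hC'le, ?_⟩
  · -- `G ≤ Kᗮ`
    rw [hG, Submodule.map_le_iff_le_comap]
    intro x _
    rw [Submodule.mem_comap, hPapp]
    exact starProjection_apply_mem _ _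
  · -- dimension
    rw [hGrank]
    exact le_trans (Nat.sub_le_sub_left hIcard _) hC'rank
  · -- the key inequality
    intro v hv
    set u := G.starProjection v with hu
    have huG : u ∈ G := starProjection_apply_mem _ _
    obtain ⟨x, hxC', hxu⟩ := Submodule.mem_map.1 huG
    have hxC : (x : V) ∈ C := (Submodule.mem_inf.1 hxC').1
    -- `‖u‖² = re ⟪u, v⟫ = re ⟪x, P_C v⟫ ≤ ‖x‖ ‖P_C v‖`
    have h1 : ‖u‖ ^ 2 = RCLike.re ⟪u, v⟫_ℂ := by
      rw [hu, re_inner_starProjection_eq_normSq, starProjection_apply, coe_norm]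
    have h2 : ⟪u, v⟫_ℂ = ⟪x, C.starProjection v⟫_ℂ := by
      rw [← hxu, hPapp, inner_starProjection_left_eq_right, starProjection_eq_self_iff.2 hv,
        ← inner_starProjection_left_eq_right, starProjection_eq_self_iff.2 hxC]
    have h3 : ‖u‖ ^ 2 ≤ ‖x‖ * ‖C.starProjection v‖ := by
      rw [h1, h2]; exact re_inner_le_norm _ _
    have h4 : ‖x‖ ^ 2 ≤ 2 * ‖u‖ ^ 2 := by
      have := hbig x hxC'; rwa [← hPapp, hxu] at this
    have ha0 : 0 ≤ ‖u‖ ^ 2 := by positivity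
    have hmul : ‖u‖ ^ 2 * ‖u‖ ^ 2 ≤ ‖u‖ ^ 2 * (2 * ‖C.starProjection v‖ ^ 2) :=
      calc ‖u‖ ^ 2 * ‖u‖ ^ 2
          ≤ (‖x‖ * ‖C.starProjection v‖) * (‖x‖ * ‖C.starProjection v‖) :=
            mul_le_mul h3 h3 ha0 (by positivity)
        _ = ‖x‖ ^ 2 * ‖C.starProjection v‖ ^ 2 := by ring
        _ ≤ (2 * ‖u‖ ^ 2) * ‖C.starProjection v‖ ^ 2 := by gcongr
        _ = ‖u‖ ^ 2 * (2 * ‖C.starProjection v‖ ^ 2) := by ring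
    rcases ha0.eq_or_lt with h0 | hpos
    · rw [← h0]; positivity
    · exact le_of_mul_le_mul_left hmul hpos

end LinAlg

/-! ### The conditional small-ball bound for one column -/

section Column

variable {N : ℕ}

/-- `‖P_G g‖² = ‖first block of coordinates‖²` in an orthonormal basis adapted to `G ⊕ Gᗮ`.
[folklore] -/
theorem norm_sq_starProjection_eq_euclSplit_fst {V : Type*} [NormedAddCommGroup V]
    [InnerProductSpace ℂ V] [FiniteDimensional ℂ V] (G : Submodule ℂ V) {ι₁ ι₂ : Type*}
    [Fintype ι₁] [Fintype ι₂] (b₁ : OrthonormalBasis ι₁ ℂ G) (b₂ : OrthonormalBasis ι₂ ℂ Gᗮ)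
    (g : V) :
    ‖G.starProjection g‖ ^ 2 = ‖(euclSplit ((G.sumOrthonormalBasis b₁ b₂).repr g)).1‖ ^ 2 := by
  rw [norm_sq_starProjection_eq_sum G b₁ g, EuclideanSpace.norm_sq_eq]
  refine Finset.sum_congr rfl fun i _ => ?_
  rw [euclSplit_fst_apply, OrthonormalBasis.repr_apply_apply, Submodule.sumOrthonormalBasis_apply_inl]

/-- `‖P_{Gᗮ} g‖² = ‖second block of coordinates‖²` in an orthonormal basis adapted to `G ⊕ Gᗮ`.
[folklore] -/
theorem norm_sq_starProjection_orthogonal_eq_euclSplit_snd {V : Type*} [NormedAddCommGroup V]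
    [InnerProductSpace ℂ V] [FiniteDimensional ℂ V] (G : Submodule ℂ V) {ι₁ ι₂ : Type*}
    [Fintype ι₁] [Fintype ι₂] (b₁ : OrthonormalBasis ι₁ ℂ G) (b₂ : OrthonormalBasis ι₂ ℂ Gᗮ)
    (g : V) :
    ‖Gᗮ.starProjection g‖ ^ 2 = ‖(euclSplit ((G.sumOrthonormalBasis b₁ b₂).repr g)).2‖ ^ 2 := by
  rw [norm_sq_starProjection_eq_sum Gᗮ b₂ g, EuclideanSpace.norm_sq_eq]
  refine Finset.sum_congr rfl fun i _ => ?_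
  rw [euclSplit_snd_apply, OrthonormalBasis.repr_apply_apply, Submodule.sumOrthonormalBasis_apply_inr]

/-- **Conditional small-ball bound for one Gram–Schmidt column.** In `ℂ^N` let `K` (orthonormal
basis `w`) and `C` (`dim C < N`) be subspaces with `∑ₗ ‖P_C wₗ‖² ≤ σ`. For a standard Gaussian
vector `g` and `0 ≤ x ≤ 1/4`, the event "the normalised residual `P_{Kᗮ} g / ‖P_{Kᗮ} g‖` has
`C`-mass at most `x`" has probability at most `2^{N-1} (4x)^{dim C - ⌊2σ⌋}`. [folklore] -/
theorem stdGaussian_measure_column_event_le (K C : Submodule ℂ (EuclideanSpace ℂ (Fin N)))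
    {ι : Type*} [Fintype ι] (w : OrthonormalBasis ι ℂ K) {σ : ℝ}
    (hσ : ∑ l, ‖C.starProjection (w l : EuclideanSpace ℂ (Fin N))‖ ^ 2 ≤ σ)
    (hCN : finrank ℂ C < N) {x : ℝ} (hx0 : 0 ≤ x) (hx : x ≤ 1 / 4) :
    stdGaussian (EuclideanSpace ℂ (Fin N))
        {g | ‖C.starProjection (Kᗮ.starProjection g)‖ ^ 2 ≤ x * ‖Kᗮ.starProjection g‖ ^ 2} ≤
      ENNReal.ofReal (2 ^ (N - 1) * (4 * x) ^ (finrank ℂ C - ⌊2 * σ⌋₊)) := by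
  obtain ⟨G, hGK, hGrank, hGC, hGineq⟩ := exists_rigid_subspace K C w hσ
  have h4x1 : 4 * x ≤ 1 := by linarith
  have h4x0 : 0 ≤ 4 * x := by linarith
  set V := EuclideanSpace ℂ (Fin N) with hV
  set E : Set V :=
    {g | ‖C.starProjection (Kᗮ.starProjection g)‖ ^ 2 ≤ x * ‖Kᗮ.starProjection g‖ ^ 2} with hE
  set d : ℕ := finrank ℂ G with hd
  have hdN : d < N := lt_of_le_of_lt hGC hCN
  -- the case `d = 0`: the bound is at least `1`
  rcases Nat.eq_zero_or_pos d with hd0 | hdpos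
  · have hexp : finrank ℂ C - ⌊2 * σ⌋₊ = 0 := by omega
    rw [hexp, pow_zero, mul_one]
    refine prob_le_one.trans ?_
    exact ENNReal.one_le_ofReal.2 (one_le_pow₀ (by norm_num))
  -- adapted orthonormal basis of `G ⊕ Gᗮ`
  have hGo : finrank ℂ Gᗮ = N - d := by
    have := G.finrank_add_finrank_orthogonal
    rw [finrank_euclideanSpace, Fintype.card_fin] at this
    omega
  set b₁ : OrthonormalBasis (Fin d) ℂ G := stdOrthonormalBasis ℂ G with hb₁
  set b₂ : OrthonormalBasis (Fin (N - d)) ℂ Gᗮ := (stdOrthonormalBasis ℂ Gᗮ).reindex (finCongr hGo)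
    with hb₂
  set Bs : OrthonormalBasis (Fin d ⊕ Fin (N - d)) ℂ V := G.sumOrthonormalBasis b₁ b₂ with hBs
  set φ : V → EuclideanSpace ℂ (Fin d) × EuclideanSpace ℂ (Fin (N - d)) :=
    fun g => euclSplit (Bs.repr g) with hφ
  have hφm : Measurable φ :=
    ((EuclideanSpace.sumEquivProd (𝕜 := ℂ) (ι := Fin d) (κ := Fin (N - d))).continuous.comp
      Bs.repr.continuous).measurable
  set S : Set (EuclideanSpace ℂ (Fin d) × EuclideanSpace ℂ (Fin (N - d))) :=
    {p | ‖p.1‖ ^ 2 ≤ (4 * x) * ‖p.2‖ ^ 2} with hS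
  -- `E ⊆ φ ⁻¹ S`
  have hsub : E ⊆ φ ⁻¹' S := by
    intro g hg
    rw [hE, Set.mem_setOf_eq] at hg
    rw [Set.mem_preimage, hS, Set.mem_setOf_eq, hφ]
    dsimp only
    rw [← norm_sq_starProjection_eq_euclSplit_fst G b₁ b₂ g,
      ← norm_sq_starProjection_orthogonal_eq_euclSplit_snd G b₁ b₂ g]
    have h1 := hGineq (Kᗮ.starProjection g) (starProjection_apply_mem _ _)
    have h2 : G.starProjection (Kᗮ.starProjection g) = G.starProjection g := by
      show (G.starProjection ∘L Kᗮ.starProjection) g = _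
      rw [starProjection_comp_starProjection_of_le hGK]
    rw [h2] at h1
    have h3 : ‖Kᗮ.starProjection g‖ ^ 2 ≤ ‖g‖ ^ 2 := by
      have := norm_sq_eq_add_norm_sq_starProjection g K
      nlinarith [sq_nonneg ‖K.starProjection g‖]
    have h4 := norm_sq_eq_add_norm_sq_starProjection g G
    have h5 : ‖G.starProjection g‖ ^ 2 ≤ 2 * x * ‖g‖ ^ 2 := by
      calc ‖G.starProjection g‖ ^ 2 ≤ 2 * ‖C.starProjection (Kᗮ.starProjection g)‖ ^ 2 := h1
        _ ≤ 2 * (x * ‖Kᗮ.starProjection g‖ ^ 2) := by gcongr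
        _ ≤ 2 * (x * ‖g‖ ^ 2) := by gcongr
        _ = 2 * x * ‖g‖ ^ 2 := by ring
    rw [h4] at h5
    nlinarith [sq_nonneg ‖G.starProjection g‖, sq_nonneg ‖Gᗮ.starProjection g‖]
  -- the Gaussian computation in the coordinates of `Bs`
  have hSm : MeasurableSet S := measurableSet_normSq_le_mul_normSq (4 * x)
  have hlaw := map_euclSplit_repr_stdGaussian Bs
  calc stdGaussian V E ≤ stdGaussian V (φ ⁻¹' S) := measure_mono hsub
    _ = ((stdGaussian V).map φ) S := (Measure.map_apply hφm hSm).symm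
    _ = ((stdGaussian (EuclideanSpace ℂ (Fin d))).prod
          (stdGaussian (EuclideanSpace ℂ (Fin (N - d))))) S := by rw [hφ, hlaw]
    _ ≤ ENNReal.ofReal ((4 * x) ^ d * ((d + (N - d) - 1).choose d : ℝ)) :=
        stdGaussian_prod_measure_normSq_le_choose hdpos (by omega) h4x0
    _ ≤ ENNReal.ofReal (2 ^ (N - 1) * (4 * x) ^ (finrank ℂ C - ⌊2 * σ⌋₊)) := by
        refine ENNReal.ofReal_le_ofReal ?_
        have h1 : (4 * x) ^ d ≤ (4 * x) ^ (finrank ℂ C - ⌊2 * σ⌋₊) :=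
          pow_le_pow_of_le_one h4x0 h4x1 hGrank
        have h2 : ((d + (N - d) - 1).choose d : ℝ) ≤ 2 ^ (N - 1) := by
          rw [show d + (N - d) - 1 = N - 1 by omega]
          exact_mod_cast Nat.choose_le_two_pow (N - 1) d
        calc (4 * x) ^ d * ((d + (N - d) - 1).choose d : ℝ)
            ≤ (4 * x) ^ (finrank ℂ C - ⌊2 * σ⌋₊) * 2 ^ (N - 1) :=
              mul_le_mul h1 h2 (by positivity) (by positivity)
          _ = _ := mul_comm _ _

end Column



end Summit.QuantumFields.YangMills.Theorems.EguchiKawaiDirectionLadder.HaarColumns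

end
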